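import Summits.CriticalPhenomena.PercolationContinuityZ3.Theorems.Transplant.DiagramComparisonAmenable
import Literature.Barriers.CriticalPhenomena.MassTransportPrincipleQuasiTransitive
import HarnessLib

/-!
# Re-rooting Hutchcroft's diagrams by the mass-transport principle: the midpoint-rooted `A₀_p, B₀_p` (the forms the tree-graph pairings produce) equal the
# hub-rooted `diagA, diagB` of «DiagramComparisonAmenable» on a unimodular vertex-transitive graph

Definition + proof file (`--kind definition`: the two original-form diagrams; `--supports stmt-CriticalPhenomena-4575 --as helper`), lane `prim-bschramm`, seat
`prim-bschramm-gen-1` gen 12 (GEN pen); RULING R-584-1 (lead g29 #10150; located by g12 #10146 / p5-g35 #10149): Hutchcroft 2022 §1.2 p. 5 DEFINES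
`A_β = Σ_{v,w,x,y} T(o,w)T(o,v)T(w,x)T(v,x)T(v,y)T(y,x)` and `B_β = Σ_{v,w,x,y} T(o,w)T(o,v)T(w,x)T(v,x)T(w,y)T(v,y)` (root `o` a MIDPOINT) and remarks «when G is unimodular,
the mass-transport principle allows us to exchange the roles of o and v to write these sums more succinctly as A_β = Σ_x T(o,x)T²(o,x)T³(o,x) and B_β = Σ_w T²(o,w)³»
(the hub-rooted forms = c2's `diagA`/`diagB`).  This file is exactly that ONE bridging step: the MTP of the tree («MassTransportPrincipleQuasiTransitive»
`sum_inv_autWeight_mul_tsum_eq`, Lyons–Peres (8.11)) specialised to a transitive graph (`tsum_eq_tsum_of_unimodular`: `Σ_z f(o,z) = Σ_y f(y,o)` for diagonally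
`Aut(G)`-invariant `f ≥ 0`), and **`diagB₀_eq_diagB`, `diagA₀_eq_diagA (hconn) (htr) (hU : IsGraphUnimodular G)`**.  builds on p205010 (kernel theorem, internal audit
signed; external expert review pending) — nothing here uses p205010.  No instance, no notation, no sorry; nothing about `θ(p_c)`.
[cite: Hutchcroft2022Triangle, §1.2 p. 5 ((1.10)–(1.11) and the MTP remark)] [cite: LyonsPeres2016, §8.2 (8.11), Cor. 8.11]
-/

noncomputable section

namespace Summit.CriticalPhenomena.PercolationContinuityZ3.Theorems.Transplant

namespace Grigorchuk

namespace NcHaraSlade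

open SimpleGraph Finset MeasureTheory Filter Literature.Probability.Percolation Literature.Barriers.CriticalPhenomena
open scoped ENNReal

variable {V : Type} [DecidableEq V] (G : SimpleGraph V) [G.LocallyFinite]

/-! ## §1 The original (midpoint-rooted) diagrams -/

/-- Summand of the ORIGINAL `A_β` at root `o` and `q = (v, w, x, y)`: `T(o,w)T(o,v)T(w,x)T(v,x)T(v,y)T(y,x)` (θ-graph, hubs `v, x`; root `o` on the 3-path next to `v`).
[cite: Hutchcroft2022Triangle, §1.2 p. 5 (definition of A_β)] -/
def summandA₀ (G : SimpleGraph V) (p : unitInterval) (o : V) (q : V × V × V × V) : ℝ :=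
  conn G p o q.2.1 * conn G p o q.1 * conn G p q.2.1 q.2.2.1 * conn G p q.1 q.2.2.1 * conn G p q.1 q.2.2.2 * conn G p q.2.2.2 q.2.2.1

/-- Summand of the ORIGINAL `B_β` at root `o` and `q = (v, w, x, y)`: `T(o,w)T(o,v)T(w,x)T(v,x)T(w,y)T(v,y)` (`K_{2,3}`, hubs `w, v`; root `o` a midpoint).
[cite: Hutchcroft2022Triangle, §1.2 p. 5 (definition of B_β)] -/
def summandB₀ (G : SimpleGraph V) (p : unitInterval) (o : V) (q : V × V × V × V) : ℝ :=
  conn G p o q.2.1 * conn G p o q.1 * conn G p q.2.1 q.2.2.1 * conn G p q.1 q.2.2.1 * conn G p q.2.1 q.2.2.2 * conn G p q.1 q.2.2.2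

/-- **`A₀_p(o)`** — Hutchcroft's `A_β` in its original (midpoint-rooted) form, in `[0, ∞]`. [cite: Hutchcroft2022Triangle, §1.2 p. 5] -/
def diagA₀ (G : SimpleGraph V) (o : V) (p : unitInterval) : ℝ≥0∞ := ∑' q : V × V × V × V, ENNReal.ofReal (summandA₀ G p o q)

/-- **`B₀_p(o)`** — Hutchcroft's `B_β` in its original (midpoint-rooted) form, in `[0, ∞]`. [cite: Hutchcroft2022Triangle, §1.2 p. 5] -/
def diagB₀ (G : SimpleGraph V) (o : V) (p : unitInterval) : ℝ≥0∞ := ∑' q : V × V × V × V, ENNReal.ofReal (summandB₀ G p o q)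

/-! ## §2 The mass-transport principle on a transitive unimodular graph -/

omit [DecidableEq V] in
/-- **MTP, transitive form**: for a connected, vertex-transitive, UNIMODULAR locally finite graph and a diagonally `Aut(G)`-invariant `f : V → V → [0,∞]`,
`Σ_z f(o, z) = Σ_y f(y, o)` (Lyons–Peres (8.11) with one orbit). [cite: LyonsPeres2016, §8.2 (8.11), Cor. 8.11] -/
theorem tsum_eq_tsum_of_unimodular (hconn : G.Connected) (htr : IsGraphTransitive G) (hU : IsGraphUnimodular G) {f : V → V → ℝ≥0∞}
    (hf : ∀ (γ : G ≃g G) (x y : V), f (γ x) (γ y) = f x y) (o : V) : ∑' z, f o z = ∑' y, f y o := by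
  have hR : ∀ v : V, ∃ r ∈ ({o} : Finset V), v ∈ autOrbit G r := fun v => by
    obtain ⟨γ, hγ⟩ := htr o v
    exact ⟨o, Finset.mem_singleton_self o, ⟨γ, hγ⟩⟩
  have hR' : ∀ r ∈ ({o} : Finset V), ∀ r' ∈ ({o} : Finset V), r' ∈ autOrbit G r → r = r' := by
    intro r hr r' hr' _
    rw [Finset.mem_singleton] at hr hr'
    rw [hr, hr']
  have h := sum_inv_autWeight_mul_tsum_eq G hconn hU {o} hR hR' hf o
  rw [Finset.sum_singleton, Finset.sum_singleton] at h
  have h0 : (autWeight G o o)⁻¹ ≠ 0 := ENNReal.inv_ne_zero.2 (autWeight_ne_top G hconn o o)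
  have htop : (autWeight G o o)⁻¹ ≠ ⊤ := ENNReal.inv_ne_top.2 (autWeight_ne_zero G hconn o o)
  exact (ENNReal.mul_right_inj h0 htop).1 h

/-! ## §3 Re-rooting `B` and `A` -/

omit [DecidableEq V] [G.LocallyFinite] in
/-- Reassociation `V⁴ = V × V³` of an `ℝ≥0∞` series. [folklore] -/
theorem tsum_prod_four_eq (g : V × V × V × V → ℝ≥0∞) : ∑' q : V × V × V × V, g q = ∑' v : V, ∑' r : V × V × V, g (v, r) :=
  ENNReal.tsum_prod'

omit [DecidableEq V] [G.LocallyFinite] in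
/-- Transport of an inner `V³`-sum by an automorphism. [folklore] -/
theorem tsum_prod_three_comp_iso (γ : G ≃g G) (g : V × V × V → ℝ≥0∞) :
    ∑' r : V × V × V, g (γ r.1, γ r.2.1, γ r.2.2) = ∑' r : V × V × V, g r := by
  set e : V × V × V ≃ V × V × V := Equiv.prodCongr γ.toEquiv (Equiv.prodCongr γ.toEquiv γ.toEquiv) with he
  symm
  rw [← e.tsum_eq]
  refine tsum_congr fun r => ?_
  simp only [he, Equiv.prodCongr_apply, Prod.map, RelIso.coe_fn_toEquiv]

omit [DecidableEq V] in
/-- **`B₀_p(o) = B_p(o)`** on a connected vertex-transitive UNIMODULAR graph: the root of the `K_{2,3}` moves from a midpoint to a hub by the MTP applied to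
`f(a,b) = Σ_{w,x,y} T(a,w)T(a,b)T(w,x)T(b,x)T(w,y)T(b,y)`. [cite: Hutchcroft2022Triangle, §1.2 p. 5 (MTP remark)] -/
theorem diagB₀_eq_diagB (hconn : G.Connected) (htr : IsGraphTransitive G) (hU : IsGraphUnimodular G) (o : V) (p : unitInterval) :
    diagB₀ G o p = diagB G o p := by
  -- the transported function: `a` in the midpoint slot, `b` in the hub slot
  set f : V → V → ℝ≥0∞ := fun a b => ∑' r : V × V × V,
    ENNReal.ofReal (conn G p a r.1 * conn G p a b * conn G p r.1 r.2.1 * conn G p b r.2.1 * conn G p r.1 r.2.2 * conn G p b r.2.2) with hf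
  have hfi : ∀ (γ : G ≃g G) (x y : V), f (γ x) (γ y) = f x y := by
    intro γ x y
    simp only [hf]
    rw [← tsum_prod_three_comp_iso G γ]
    simp only [conn_iso]
  have hmtp := tsum_eq_tsum_of_unimodular G hconn htr hU hfi o
  -- `B₀(o) = Σ_v f(o,v)` and `Σ_v f(v,o) = B(o)`
  have h1 : diagB₀ G o p = ∑' v, f o v := by
    unfold diagB₀
    rw [tsum_prod_four_eq]
    refine tsum_congr fun v => tsum_congr fun r => ?_
    simp only [summandB₀]
  have h2 : ∑' v, f v o = diagB G o p := by
    set F : V × (V × V × V) → ℝ≥0∞ := fun a =>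
      ENNReal.ofReal (conn G p a.1 a.2.1 * conn G p a.1 o * conn G p a.2.1 a.2.2.1 * conn G p o a.2.2.1 * conn G p a.2.1 a.2.2.2 * conn G p o a.2.2.2) with hF
    set e4 : V × (V × V × V) ≃ V × V × V × V :=
      ⟨fun a => (a.2.1, a.1, a.2.2.1, a.2.2.2), fun q => (q.2.1, q.1, q.2.2.1, q.2.2.2), fun _ => rfl, fun _ => rfl⟩ with he4
    unfold diagB
    calc ∑' v, f v o = ∑' v, ∑' r : V × V × V, F (v, r) := rfl
      _ = ∑' a : V × (V × V × V), F a := ENNReal.tsum_prod'.symm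
      _ = ∑' q : V × V × V × V, F (e4.symm q) := (e4.symm.tsum_eq F).symm
      _ = ∑' q : V × V × V × V, ENNReal.ofReal (summandB G p o q) := by
          refine tsum_congr fun q => ?_
          simp only [hF, he4, Equiv.coe_fn_symm_mk, summandB]
          rw [conn_comm G p q.2.1 o, conn_comm G p q.1 q.2.2.1, conn_comm G p q.1 q.2.2.2]
          congr 1
          ring
  rw [h1, hmtp, h2]

omit [DecidableEq V] in
/-- **`A₀_p(o) = A_p(o)`** on a connected vertex-transitive UNIMODULAR graph: MTP applied to `f(a,b) = Σ_{w,x,y} T(a,w)T(a,b)T(w,x)T(b,x)T(b,y)T(y,x)` (θ-graph, hubs `b, x`;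
`a` on the 3-path next to `b`). [cite: Hutchcroft2022Triangle, §1.2 p. 5 (MTP remark)] -/
theorem diagA₀_eq_diagA (hconn : G.Connected) (htr : IsGraphTransitive G) (hU : IsGraphUnimodular G) (o : V) (p : unitInterval) :
    diagA₀ G o p = diagA G o p := by
  set f : V → V → ℝ≥0∞ := fun a b => ∑' r : V × V × V,
    ENNReal.ofReal (conn G p a r.1 * conn G p a b * conn G p r.1 r.2.1 * conn G p b r.2.1 * conn G p b r.2.2 * conn G p r.2.2 r.2.1) with hf
  have hfi : ∀ (γ : G ≃g G) (x y : V), f (γ x) (γ y) = f x y := by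
    intro γ x y
    simp only [hf]
    rw [← tsum_prod_three_comp_iso G γ]
    simp only [conn_iso]
  have hmtp := tsum_eq_tsum_of_unimodular G hconn htr hU hfi o
  have h1 : diagA₀ G o p = ∑' v, f o v := by
    unfold diagA₀
    rw [tsum_prod_four_eq]
    refine tsum_congr fun v => tsum_congr fun r => ?_
    simp only [summandA₀]
  have h2 : ∑' v, f v o = diagA G o p := by
    set F : V × (V × V × V) → ℝ≥0∞ := fun a =>
      ENNReal.ofReal (conn G p a.1 a.2.1 * conn G p a.1 o * conn G p a.2.1 a.2.2.1 * conn G p o a.2.2.1 * conn G p o a.2.2.2 * conn G p a.2.2.2 a.2.2.1) with hF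
    set e4 : V × (V × V × V) ≃ V × V × V × V :=
      ⟨fun a => (a.2.2.1, a.2.2.2, a.1, a.2.1), fun q => (q.2.2.1, (q.2.2.2, q.1, q.2.1)), fun _ => rfl, fun _ => rfl⟩ with he4
    unfold diagA
    calc ∑' v, f v o = ∑' v, ∑' r : V × V × V, F (v, r) := rfl
      _ = ∑' a : V × (V × V × V), F a := ENNReal.tsum_prod'.symm
      _ = ∑' q : V × V × V × V, F (e4.symm q) := (e4.symm.tsum_eq F).symm
      _ = ∑' q : V × V × V × V, ENNReal.ofReal (summandA G p o q) := by
          refine tsum_congr fun q => ?_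
          simp only [hF, he4, Equiv.coe_fn_symm_mk, summandA]
          rw [conn_comm G p q.2.2.1 o]
          congr 1
          ring
  rw [h1, hmtp, h2]

end NcHaraSlade

end Grigorchuk

end Summit.CriticalPhenomena.PercolationContinuityZ3.Theorems.Transplant

end
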